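import Summits.QuantumFields.YangMills.Theorems.SwapVirialDeficitBlowUpFollowerMinimiser
import Summits.QuantumFields.YangMills.Theorems.SwapVirialDeficitBlowUpSignPatternsLargeField
import Summits.QuantumFields.YangMills.Theorems.WeakCouplingRatesColdBoxGnomonicInverse
import Summits.QuantumFields.YangMills.Theorems.LuscherReductionOneSiteLevelsMagnetic
import HarnessLib

/-!
# (T1) in gnomonic coordinates: over a near-flat base the FOLLOWER MINIMISER LIES IN THE ALL-PLUS GNOMONIC CHART, so `m_z(C) = min_{η_F} F̂_z(C, η_F)` exists
# in LEAD ym-line-sfw-p2 g97's coordinates and equals the minimum over the compact fibre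
# (free-hands support of ⟨stmt-QuantumFields-24197⟩ `SwapVirialDeficit.SwapGluedStiffness`; brick W6 (T1), chart ∕ gnomonic bridge)

✓`exists_chartDeficit_eq_iInf` gives a minimiser `U₀` of `U ↦ F̂_z(C,U)` on the compact group `SU(2)^{Fol L}`; ✓`follower_minimiser_near_one[_twisted]` puts every
`U₀_f` within `48L³√F̂_z(C,1)` of `1`; ✓`two_le_frobNorm_sub_one_of_re_nonpos` says the closed negative hemisphere is at Frobenius distance `≥ 2` from `1`.  Hence on the
NEAR-FLAT BASE `{F̂_z(C,1) < 1/(576L⁶)}` (e.g. signed relations `≤ s` with `300L⁴s² < 1/(576L⁶)`) every minimiser has all followers in the OPEN POSITIVE HEMISPHERE, which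
the gnomonic letter `v ↦ quatToSU2 (gnoLetter true v) = (1,v)/‖(1,v)‖` covers (✓`WeakCouplingRates.exists_gnomonicChart_eq_of_trace_pos`):
* `re_su2Quat_pos_of_frobNorm_sub_one_lt_two`, `exists_gnoLetter_true_eq_of_re_pos` (the chart covers `{re q > 0}`), `sqrt_flatThreshold` (`48L³·√(1/(576L⁶)) = 2`);
* ★★ `follower_minimiser_re_pos[_twisted]` — near-flat base ⟹ every follower of a minimiser has `re q(U₀_f) > 0`;
* ★★★ `exists_follower_minimiser_gnomonic[_twisted]` — `∃ η_F : Fol L → ℝ³` minimising `F̂_z(C, ·)` over ALL of `SU(2)^{Fol L}` through the all-plus gnomonic chart;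
* ★★ `iInf_chartDeficit_eq_iInf_gnomonic[_twisted]` — `⨅_{U ∈ SU(2)^{Fol}} F̂_z(C,U) = ⨅_{η_F ∈ (ℝ³)^{Fol}} F̂_z(C, gno⁺(η_F))`: LEAD's `m(P̃) := min_{η_F} F̂` IS the compact-fibre
  minimum, so ✓`continuous_iInf_chartDeficit` ∕ ✓`sigmaMaxSq_div_le_iInf_chartDeficit` ∕ ✓`iInf_chartDeficit_le_of_relations` transfer verbatim to the gnomonic frame.

HONEST LABEL: bookkeeping on landed inequalities; ⟨24197⟩ (window-uniform) ∕ ⟨24196⟩ ∕ ⟨24194⟩ ∕ ⟨24497⟩ OPEN; own crux ⟨22884⟩ OPEN (blocked-on ⟨19935⟩); no crux, rung of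
record or summit is proved; the Yang–Mills mass gap is NOT proved; no summit is proved by a line.  THEOREMS ONLY (0 `def`, 0 `sorry`), standard axioms.
Width seat ym-line-sfw-p2-w3 g65 (cell ym-idea-1, free hands), `--supports stmt-QuantumFields-24197`.  References: [cite: Luscher1983, §2]; [folklore].
-/

set_option autoImplicit false

noncomputable section

open MeasureTheory Quaternion
open scoped BigOperators Quaternion
open Literature.MathematicalPhysics.QuantumFieldTheory hiding SU2
open Literature.MathematicalPhysics.QuantumLattice

namespace Summit.QuantumFields.YangMills.Theorems.SwapVirialDeficit.BlowUpRing

open Summit.QuantumFields.YangMills.Theorems.FemtoTransferGap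
open Summit.QuantumFields.YangMills.Theorems.FemtoTransferGap.TT
open Summit.QuantumFields.YangMills.Theorems.VirialFluxGap.RingDeficit
open Summit.QuantumFields.YangMills.Theorems.SwapVirialDeficit.SwapRing
open Summit.QuantumFields.YangMills.Theorems.WeakCouplingRates (gnomonicChart exists_gnomonicChart_eq_of_trace_pos)

variable {L : ℕ} [NeZero L]

/-! ## §1 The positive hemisphere and the all-plus gnomonic chart -/

omit [NeZero L] in
/-- Frobenius distance `< 2` from the identity forces a positive scalar part. [folklore] -/
theorem re_su2Quat_pos_of_frobNorm_sub_one_lt_two (U : SU2) (h : frobNorm ((U : Matrix (Fin 2) (Fin 2) ℂ) - 1) < 2) : 0 < (su2Quat U).re := by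
  by_contra hle
  exact absurd (two_le_frobNorm_sub_one_of_re_nonpos U (not_lt.1 hle)) (not_le.2 h)

omit [NeZero L] in
/-- The all-plus gnomonic letter covers the open positive hemisphere: `re q(U) > 0 ⟹ U = quatToSU2 (gnoLetter true v)` for some `v ∈ ℝ³`. [folklore] -/
theorem exists_gnoLetter_true_eq_of_re_pos (U : SU2) (h : 0 < (su2Quat U).re) : ∃ v : Fin 3 → ℝ, quatToSU2 (gnoLetter true v) = U := by
  have htr : 0 < ((U : Matrix (Fin 2) (Fin 2) ℂ).trace).re := by rw [su2_trace_re_eq_quat]; linarith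
  obtain ⟨v, hv⟩ := exists_gnomonicChart_eq_of_trace_pos U htr
  refine ⟨v, ?_⟩
  have e : gnoLetter true v = gnomonicQuat v := by simp [gnoLetter]
  rw [e]; exact hv

/-- `48·L³·√(1/(576·L⁶)) = 2`. [folklore] -/
theorem sqrt_flatThreshold : 48 * (L : ℝ) ^ 3 * Real.sqrt (1 / (576 * (L : ℝ) ^ 6)) = 2 := by
  have hL : (0 : ℝ) < L := by exact_mod_cast NeZero.pos L
  have hL3 : (0 : ℝ) < (L : ℝ) ^ 3 := by positivity
  have e : 1 / (576 * (L : ℝ) ^ 6) = (1 / (24 * (L : ℝ) ^ 3)) ^ 2 := by field_simp; ring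
  rw [e, Real.sqrt_sq (by positivity)]
  field_simp
  norm_num

/-- ★★ **Near-flat base ⟹ every follower of a minimiser is in the open positive hemisphere** (every sector): if `F̂_z(C, 1) < 1/(576·L⁶)` and `U₀`
minimises `F̂_z(C, ·)`, then `re q(U₀_i) > 0` for all `i`. [cite: Luscher1983, §2] -/
theorem follower_minimiser_re_pos_twisted (z : Fin 3 → Bool) (C : Fin 4 → SU2) {U₀ : Fol L → SU2}
    (hmin : ∀ U : Fol L → SU2,
      chartDeficit L z (fun x => centreElem (Bool.xor (z 0 && decide (x 0 ≠ 0)) (Bool.xor (z 1 && decide (x 1 ≠ 0)) (z 2 && decide (x 2 ≠ 0))))) (C, U₀) ≤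
        chartDeficit L z (fun x => centreElem (Bool.xor (z 0 && decide (x 0 ≠ 0)) (Bool.xor (z 1 && decide (x 1 ≠ 0)) (z 2 && decide (x 2 ≠ 0))))) (C, U))
    (hflat : chartDeficit L z (fun x => centreElem (Bool.xor (z 0 && decide (x 0 ≠ 0)) (Bool.xor (z 1 && decide (x 1 ≠ 0)) (z 2 && decide (x 2 ≠ 0)))))
      (C, fun _ => 1) < 1 / (576 * (L : ℝ) ^ 6))
    (i : Fol L) : 0 < (su2Quat (U₀ i)).re := by
  have h := (follower_minimiser_near_one_twisted (L := L) z C hmin i).2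
  have hF0 := chartDeficit_nonneg (L := L) z
    (fun x : Site 3 L => centreElem (Bool.xor (z 0 && decide (x 0 ≠ 0)) (Bool.xor (z 1 && decide (x 1 ≠ 0)) (z 2 && decide (x 2 ≠ 0))))) (C, fun _ => (1 : SU2))
  have hL : (0 : ℝ) < L := by exact_mod_cast NeZero.pos L
  have hlt : 48 * (L : ℝ) ^ 3 * Real.sqrt (chartDeficit L z
      (fun x => centreElem (Bool.xor (z 0 && decide (x 0 ≠ 0)) (Bool.xor (z 1 && decide (x 1 ≠ 0)) (z 2 && decide (x 2 ≠ 0))))) (C, fun _ => 1)) < 2 := by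
    rw [← sqrt_flatThreshold (L := L)]
    exact mul_lt_mul_of_pos_left (Real.sqrt_lt_sqrt hF0 hflat) (by positivity)
  exact re_su2Quat_pos_of_frobNorm_sub_one_lt_two (U₀ i) (h.trans_lt hlt)

/-- ★★ **The principal-sector twin** (`χ ≡ 1`). [cite: Luscher1983, §2] -/
theorem follower_minimiser_re_pos (C : Fin 4 → SU2) {U₀ : Fol L → SU2}
    (hmin : ∀ U : Fol L → SU2, chartDeficit L (fun _ => false) (fun _ => 1) (C, U₀) ≤ chartDeficit L (fun _ => false) (fun _ => 1) (C, U))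
    (hflat : chartDeficit L (fun _ => false) (fun _ => 1) (C, fun _ => 1) < 1 / (576 * (L : ℝ) ^ 6)) (i : Fol L) :
    0 < (su2Quat (U₀ i)).re := by
  have h := (follower_minimiser_near_one (L := L) C hmin i).2
  have hF0 := chartDeficit_nonneg (L := L) (fun _ => false) (fun _ => (1 : SU2)) (C, fun _ => (1 : SU2))
  have hL : (0 : ℝ) < L := by exact_mod_cast NeZero.pos L
  have hlt : 48 * (L : ℝ) ^ 3 * Real.sqrt (chartDeficit L (fun _ => false) (fun _ => 1) (C, fun _ => 1)) < 2 := by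
    rw [← sqrt_flatThreshold (L := L)]
    exact mul_lt_mul_of_pos_left (Real.sqrt_lt_sqrt hF0 hflat) (by positivity)
  exact re_su2Quat_pos_of_frobNorm_sub_one_lt_two (U₀ i) (h.trans_lt hlt)

/-! ## §2 The minimiser through the gnomonic chart; the two minima agree -/

/-- ★★★ **THE FOLLOWER MINIMISER IN GNOMONIC COORDINATES** (every sector): over a near-flat base (`F̂_z(C,1) < 1/(576L⁶)`) there are follower coordinates
`η_F : Fol L → ℝ³` whose all-plus gnomonic image MINIMISES `F̂_z(C, ·)` over the whole compact fibre `SU(2)^{Fol L}` — LEAD g97's «`m(P̃) := min_{η_F} F̂` exists»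
in his coordinates. [cite: Luscher1983, §2] -/
theorem exists_follower_minimiser_gnomonic_twisted (z : Fin 3 → Bool) (C : Fin 4 → SU2)
    (hflat : chartDeficit L z (fun x => centreElem (Bool.xor (z 0 && decide (x 0 ≠ 0)) (Bool.xor (z 1 && decide (x 1 ≠ 0)) (z 2 && decide (x 2 ≠ 0)))))
      (C, fun _ => 1) < 1 / (576 * (L : ℝ) ^ 6)) :
    ∃ η : Fol L → Fin 3 → ℝ, ∀ U : Fol L → SU2,
      chartDeficit L z (fun x => centreElem (Bool.xor (z 0 && decide (x 0 ≠ 0)) (Bool.xor (z 1 && decide (x 1 ≠ 0)) (z 2 && decide (x 2 ≠ 0)))))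
          (C, fun i => quatToSU2 (gnoLetter true (η i))) ≤
        chartDeficit L z (fun x => centreElem (Bool.xor (z 0 && decide (x 0 ≠ 0)) (Bool.xor (z 1 && decide (x 1 ≠ 0)) (z 2 && decide (x 2 ≠ 0))))) (C, U) := by
  obtain ⟨U₀, hmin⟩ := exists_follower_minimiser (L := L) z
    (fun x => centreElem (Bool.xor (z 0 && decide (x 0 ≠ 0)) (Bool.xor (z 1 && decide (x 1 ≠ 0)) (z 2 && decide (x 2 ≠ 0))))) C
  have hre := follower_minimiser_re_pos_twisted (L := L) z C hmin hflat
  choose η hη using fun i => exists_gnoLetter_true_eq_of_re_pos (U₀ i) (hre i)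
  refine ⟨η, fun U => ?_⟩
  have e : (fun i => quatToSU2 (gnoLetter true (η i))) = U₀ := funext hη
  rw [e]; exact hmin U

/-- ★★★ **The principal-sector twin** (`χ ≡ 1`). [cite: Luscher1983, §2] -/
theorem exists_follower_minimiser_gnomonic (C : Fin 4 → SU2)
    (hflat : chartDeficit L (fun _ => false) (fun _ => 1) (C, fun _ => 1) < 1 / (576 * (L : ℝ) ^ 6)) :
    ∃ η : Fol L → Fin 3 → ℝ, ∀ U : Fol L → SU2,
      chartDeficit L (fun _ => false) (fun _ => 1) (C, fun i => quatToSU2 (gnoLetter true (η i))) ≤ chartDeficit L (fun _ => false) (fun _ => 1) (C, U) := by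
  obtain ⟨U₀, hmin⟩ := exists_follower_minimiser (L := L) (fun _ => false) (fun _ => 1) C
  have hre := follower_minimiser_re_pos (L := L) C hmin hflat
  choose η hη using fun i => exists_gnoLetter_true_eq_of_re_pos (U₀ i) (hre i)
  refine ⟨η, fun U => ?_⟩
  have e : (fun i => quatToSU2 (gnoLetter true (η i))) = U₀ := funext hη
  rw [e]; exact hmin U

/-- ★★ **THE TWO MINIMA AGREE** (every sector): on the near-flat base, `⨅_{U ∈ SU(2)^{Fol}} F̂_z(C,U) = ⨅_{η_F} F̂_z(C, gno⁺(η_F))`. [cite: Luscher1983, §2] -/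
theorem iInf_chartDeficit_eq_iInf_gnomonic_twisted (z : Fin 3 → Bool) (C : Fin 4 → SU2)
    (hflat : chartDeficit L z (fun x => centreElem (Bool.xor (z 0 && decide (x 0 ≠ 0)) (Bool.xor (z 1 && decide (x 1 ≠ 0)) (z 2 && decide (x 2 ≠ 0)))))
      (C, fun _ => 1) < 1 / (576 * (L : ℝ) ^ 6)) :
    (⨅ U : Fol L → SU2, chartDeficit L z
        (fun x => centreElem (Bool.xor (z 0 && decide (x 0 ≠ 0)) (Bool.xor (z 1 && decide (x 1 ≠ 0)) (z 2 && decide (x 2 ≠ 0))))) (C, U)) =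
      ⨅ η : Fol L → Fin 3 → ℝ, chartDeficit L z
        (fun x => centreElem (Bool.xor (z 0 && decide (x 0 ≠ 0)) (Bool.xor (z 1 && decide (x 1 ≠ 0)) (z 2 && decide (x 2 ≠ 0)))))
          (C, fun i => quatToSU2 (gnoLetter true (η i))) := by
  set χ : Site 3 L → SU2 := fun x => centreElem (Bool.xor (z 0 && decide (x 0 ≠ 0)) (Bool.xor (z 1 && decide (x 1 ≠ 0)) (z 2 && decide (x 2 ≠ 0))))
    with hχ
  obtain ⟨η₀, hη₀⟩ := exists_follower_minimiser_gnomonic_twisted (L := L) z C hflat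
  have hbdd : BddBelow (Set.range fun η : Fol L → Fin 3 → ℝ => chartDeficit L z χ (C, fun i => quatToSU2 (gnoLetter true (η i)))) :=
    ⟨0, by rintro _ ⟨η, rfl⟩; exact chartDeficit_nonneg z χ _⟩
  refine le_antisymm (le_ciInf fun η => iInf_chartDeficit_le z χ C _) ?_
  refine le_ciInf fun U => ?_
  exact (ciInf_le hbdd η₀).trans (hη₀ U)

/-- ★★ **The principal-sector twin** (`χ ≡ 1`): `⨅_U F̂(C,U) = ⨅_{η_F} F̂(C, gno⁺(η_F))` on `{F̂(C,1) < 1/(576L⁶)}`. [cite: Luscher1983, §2] -/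
theorem iInf_chartDeficit_eq_iInf_gnomonic (C : Fin 4 → SU2)
    (hflat : chartDeficit L (fun _ => false) (fun _ => 1) (C, fun _ => 1) < 1 / (576 * (L : ℝ) ^ 6)) :
    (⨅ U : Fol L → SU2, chartDeficit L (fun _ => false) (fun _ => 1) (C, U)) =
      ⨅ η : Fol L → Fin 3 → ℝ, chartDeficit L (fun _ => false) (fun _ => 1) (C, fun i => quatToSU2 (gnoLetter true (η i))) := by
  obtain ⟨η₀, hη₀⟩ := exists_follower_minimiser_gnomonic (L := L) C hflat
  have hbdd : BddBelow (Set.range fun η : Fol L → Fin 3 → ℝ => chartDeficit L (fun _ => false) (fun _ => 1) (C, fun i => quatToSU2 (gnoLetter true (η i)))) :=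
    ⟨0, by rintro _ ⟨η, rfl⟩; exact chartDeficit_nonneg _ _ _⟩
  refine le_antisymm (le_ciInf fun η => iInf_chartDeficit_le _ _ C _) ?_
  refine le_ciInf fun U => ?_
  exact (ciInf_le hbdd η₀).trans (hη₀ U)

/-- ★ **The near-flat threshold from the signed relations**: `300L⁴s² < 1/(576L⁶)` (e.g. `s < 1/(416·L⁵)`) puts `C` in the domain of the four theorems above
(✓`chartDeficit_twisted_one_le_of_relations`). [cite: Luscher1983, §2] -/
theorem flat_threshold_of_relations (z : Fin 3 → Bool) (C : Fin 4 → SU2) {s : ℝ} (hs : 0 ≤ s) (hs' : 300 * (L : ℝ) ^ 4 * s ^ 2 < 1 / (576 * (L : ℝ) ^ 6))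
    (hCC : ∀ μ ν : Fin 3, frobNorm (((C (Fin.castSucc μ) * C (Fin.castSucc ν) : SU2) : Matrix (Fin 2) (Fin 2) ℂ) -
        ((C (Fin.castSucc ν) * C (Fin.castSucc μ) : SU2) : Matrix (Fin 2) (Fin 2) ℂ)) ≤ s)
    (hσ : ∀ μ : Fin 3, frobNorm (((C (Fin.last 3) * C (Fin.castSucc (Equiv.swap (0 : Fin 3) 1 μ)) : SU2) : Matrix (Fin 2) (Fin 2) ℂ) -
        ((centreElem (z μ) * C (Fin.castSucc μ) * C (Fin.last 3) : SU2) : Matrix (Fin 2) (Fin 2) ℂ)) ≤ s) :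
    chartDeficit L z (fun x => centreElem (Bool.xor (z 0 && decide (x 0 ≠ 0)) (Bool.xor (z 1 && decide (x 1 ≠ 0)) (z 2 && decide (x 2 ≠ 0)))))
      (C, fun _ => 1) < 1 / (576 * (L : ℝ) ^ 6) :=
  (chartDeficit_twisted_one_le_of_relations (L := L) z C hs hCC hσ).trans_lt hs'

end Summit.QuantumFields.YangMills.Theorems.SwapVirialDeficit.BlowUpRing

end
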